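import Literature.Analysis.FluidPDE.SuitableWeak
import HarnessLib

/-!
# `TypeIQuarterGate.QuarterLawTypeI` (crux stmt-NavierStokesRegularity-23726), stub `stub_countQuarterLaw`
# — ONE-SCALE SMALLNESS, small tools

Helper file (`--supports stmt-NavierStokesRegularity-23726`): one measure-theoretic tool for
`TypeIQuarterGateQuarterLawTypeIOneScaleSmallness`: "a.e. bound on an open set + continuity ⇒ pointwise
bound" (the companions `HolderBridge.cknE_le_of_lintegral_le` and
`FiniteDissipationLiouville.Birth.Apex.setLIntegral_prod_le_lintegral_lintegral` are already in the tree). HONEST FRAMING: folklore; nothing about Navier–Stokes regularity is claimed. [folklore]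
-/

-- the problem directory repeats the summit name (`NavierStokesRegularity/NavierStokesRegularity`)
set_option linter.dupNamespace false

noncomputable section

open Set Filter MeasureTheory Topology Metric Function
open scoped ENNReal NNReal

namespace Summit.NavierStokesRegularity.NavierStokesRegularity.Theorems

namespace CountQuarterLaw

open Literature.Analysis.FluidPDE

/-- From an a.e. bound on an open set to a pointwise bound, for a continuous field. [folklore] -/
theorem norm_le_of_ae_of_continuousOn {u : ℝ → EuclideanSpace ℝ (Fin 3) → EuclideanSpace ℝ (Fin 3)}
    {U : Set (ℝ × EuclideanSpace ℝ (Fin 3))} (hU : IsOpen U) (hcont : ContinuousOn (uncurry u) U)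
    {c : ℝ} (h : ∀ᵐ w ∂(volume.restrict U), ‖u w.1 w.2‖ ≤ c) :
    ∀ w ∈ U, ‖u w.1 w.2‖ ≤ c := by
  set V : Set (ℝ × EuclideanSpace ℝ (Fin 3)) := U ∩ (fun w => ‖uncurry u w‖) ⁻¹' Ioi c with hV
  have hVopen : IsOpen V := (hcont.norm).isOpen_inter_preimage hU isOpen_Ioi
  have hVzero : volume V = 0 := by
    have h1 : (volume.restrict U) {w | ¬ ‖u w.1 w.2‖ ≤ c} = 0 := ae_iff.1 h
    have h2 : volume ({w | ¬ ‖u w.1 w.2‖ ≤ c} ∩ U) = 0 := by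
      rwa [Measure.restrict_apply' hU.measurableSet] at h1
    refine measure_mono_null (fun w hw => ?_) h2
    exact ⟨not_le.2 hw.2, hw.1⟩
  have hVempty : V = ∅ := (hVopen.measure_eq_zero_iff volume).1 hVzero
  intro w hw
  by_contra hlt
  push Not at hlt
  have hmem : w ∈ V := ⟨hw, hlt⟩
  rw [hVempty] at hmem
  simp at hmem

end CountQuarterLaw

end Summit.NavierStokesRegularity.NavierStokesRegularity.Theorems

end
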